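import Summits.QuantumFields.YangMills.Theorems.AllWindowsColdBoxBoxHighLineColourDiagContraction

/-!
# `ConnectedThreePoint`, QUARTIC vertices — collapse lemmas: the two-kernel rank-one collapse and the six shape groups of the 72 connected pairings
# (U5-BLOCKERS §2, lift L2 / ASSEMBLY-U5 §3)

Width seat `ym-line-sfw-p2-w3` (g41), cell ym-idea-1; U5 prep, helper-grade.  Pure finite-sum algebra used by `…QuarticVertexRankOne`:
* `ColourDiag.sum_rankOne_mul_mul₂` — `Σ_{bb'} L_{bb'}·A(b,i)·B(b',i') = c_A·c_B·[κ_i=κ_{i'}]·(Σ_e w e·x e e_i)·(Σ_e w e·y e e_{i'})` for a colour-diagonal rank-one `L`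
  (kernel `w⊗w`) and two colour-diagonal kernels `A = c_A·(x⊗1)`, `B = c_B·(y⊗1)`;
* `sumLL_X1`, `sumLL_X2`, `sumLL_T1` … `sumLL_T4` — distributing a four-fold sum over twelve pairings of one shape and collapsing each, GIVEN the shape
  collapses as hypotheses («X»: `Σ L⁰L^T·(S_aS_{a'})(S_bS_{b'}) = D⁰·D^T`; «tadpoles» T1–T4: the four orientations of the pair–pair line).  Stated for abstract
  functions on any finite index type, so every elaboration stays small (default heartbeats).

Mathlib + ✓`…ColourDiagContraction`; no definitions; standard axioms.  HONEST LABEL: bookkeeping for the RECORDED lift L2 of the NEXT rung U5 (⟨stmt-QuantumFields-24336⟩,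
UNSTAFFED); ⟨24004⟩ ⟨24336⟩ remain OPEN; route AllWindowsColdBox is DRAFT; no crux, rung or summit is proved; **the Yang–Mills mass gap is NOT proved by this file;
no summit is proved by a line.**
-/

set_option autoImplicit false

noncomputable section

open Matrix Finset

namespace Summit.QuantumFields.YangMills.Theorems.AllWindowsColdBoxBoxHighLine

namespace ColourDiag

variable {E : Type*} [Fintype E]

/-- **Rank-one collapse with two colour-diagonal kernels**: `Σ_{bb'} L_{bb'}·A(b,i)·B(b',i') = c_A·c_B·[κ_i=κ_{i'}]·(Σ_e w e·x e e_i)·(Σ_e w e·y e e_{i'})`. -/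
theorem sum_rankOne_mul_mul₂ (w : E → ℝ) (x y : E → E → ℝ) (cA cB : ℝ) {L A B : Matrix (E × Fin 3) (E × Fin 3) ℝ}
    (hL : ∀ i j, L i j = if i.2 = j.2 then w i.1 * w j.1 else 0) (hA : ∀ i j, A i j = cA * if i.2 = j.2 then x i.1 j.1 else 0)
    (hB : ∀ i j, B i j = cB * if i.2 = j.2 then y i.1 j.1 else 0) (i i' : E × Fin 3) :
    (∑ b, ∑ b', L b b' * (A b i * B b' i')) = cA * cB * if i.2 = i'.2 then (∑ e, w e * x e i.1) * (∑ e, w e * y e i'.1) else 0 := by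
  have e1 : (∑ b, ∑ b', L b b' * (A b i * B b' i')) = (Aᵀ * (L * B)) i i' := by
    simp only [Matrix.mul_apply, Matrix.transpose_apply, Finset.mul_sum]
    exact Finset.sum_congr rfl fun b _ => Finset.sum_congr rfl fun b' _ => by ring
  have hAt : ∀ p q : E × Fin 3, Aᵀ p q = if p.2 = q.2 then (fun e e' => cA * x e' e) p.1 q.1 else 0 := by
    intro p q
    rw [Matrix.transpose_apply, hA]
    by_cases h : p.2 = q.2
    · rw [if_pos h, if_pos h.symm]
    · rw [if_neg h, if_neg (Ne.symm h), mul_zero]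
  have hL' : ∀ p q : E × Fin 3, L p q = if p.2 = q.2 then (fun e e' => w e * w e') p.1 q.1 else 0 := hL
  rw [e1, colourDiag_mul_apply (x := fun e e' => cA * x e' e) hAt]
  simp only [colourDiag_mul_apply (x := fun e e' => w e * w e') hL', hB]
  rcases eq_or_ne i.2 i'.2 with h | h
  · simp only [h, if_true]
    rw [Finset.sum_mul_sum, Finset.mul_sum]
    refine Finset.sum_congr rfl fun e _ => ?_
    rw [Finset.mul_sum, Finset.mul_sum]
    exact Finset.sum_congr rfl fun e' _ => by ring
  · simp only [h, if_false, mul_zero, Finset.sum_const_zero]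

end ColourDiag

/-! ## Shape groups: distributing twelve pairings at a time (keeps every elaboration small) -/

/-- Collapse of twelve pairings of one shape group (`X1`), given the shape collapses. -/
theorem sumLL_X1 {ι : Type*} [Fintype ι] (LA LB S DA DB : ι → ι → ℝ)
    (hXc : ∀ P Q R T' : ι, (∑ a, ∑ a', ∑ b, ∑ b', LA a a' * LB b b' * ((S a P * S a' Q) * (S b R * S b' T'))) = DA P Q * DB R T')
    (n₀ n₁ n₂ n₃ : ι) :
    (∑ a, ∑ a', ∑ b, ∑ b',
      (LA a a' * LB b b' * ((S a n₀ * S a' n₁) * (S b n₂ * S b' n₃)) +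
        LA a a' * LB b b' * ((S a n₀ * S a' n₁) * (S b n₃ * S b' n₂)) +
        LA a a' * LB b b' * ((S a n₀ * S a' n₂) * (S b n₁ * S b' n₃)) +
        LA a a' * LB b b' * ((S a n₀ * S a' n₂) * (S b n₃ * S b' n₁)) +
        LA a a' * LB b b' * ((S a n₀ * S a' n₃) * (S b n₁ * S b' n₂)) +
        LA a a' * LB b b' * ((S a n₀ * S a' n₃) * (S b n₂ * S b' n₁)) +
        LA a a' * LB b b' * ((S a n₁ * S a' n₀) * (S b n₂ * S b' n₃)) +
        LA a a' * LB b b' * ((S a n₁ * S a' n₀) * (S b n₃ * S b' n₂)) +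
        LA a a' * LB b b' * ((S a n₁ * S a' n₂) * (S b n₀ * S b' n₃)) +
        LA a a' * LB b b' * ((S a n₁ * S a' n₂) * (S b n₃ * S b' n₀)) +
        LA a a' * LB b b' * ((S a n₁ * S a' n₃) * (S b n₀ * S b' n₂)) +
        LA a a' * LB b b' * ((S a n₁ * S a' n₃) * (S b n₂ * S b' n₀)))) =
      DA n₀ n₁ * DB n₂ n₃ +
      DA n₀ n₁ * DB n₃ n₂ +
      DA n₀ n₂ * DB n₁ n₃ +
      DA n₀ n₂ * DB n₃ n₁ +
      DA n₀ n₃ * DB n₁ n₂ +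
      DA n₀ n₃ * DB n₂ n₁ +
      DA n₁ n₀ * DB n₂ n₃ +
      DA n₁ n₀ * DB n₃ n₂ +
      DA n₁ n₂ * DB n₀ n₃ +
      DA n₁ n₂ * DB n₃ n₀ +
      DA n₁ n₃ * DB n₀ n₂ +
      DA n₁ n₃ * DB n₂ n₀ := by
  simp only [Finset.sum_add_distrib, hXc]

/-- Collapse of twelve pairings of one shape group (`X2`), given the shape collapses. -/
theorem sumLL_X2 {ι : Type*} [Fintype ι] (LA LB S DA DB : ι → ι → ℝ)
    (hXc : ∀ P Q R T' : ι, (∑ a, ∑ a', ∑ b, ∑ b', LA a a' * LB b b' * ((S a P * S a' Q) * (S b R * S b' T'))) = DA P Q * DB R T')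
    (n₀ n₁ n₂ n₃ : ι) :
    (∑ a, ∑ a', ∑ b, ∑ b',
      (LA a a' * LB b b' * ((S a n₂ * S a' n₀) * (S b n₁ * S b' n₃)) +
        LA a a' * LB b b' * ((S a n₂ * S a' n₀) * (S b n₃ * S b' n₁)) +
        LA a a' * LB b b' * ((S a n₂ * S a' n₁) * (S b n₀ * S b' n₃)) +
        LA a a' * LB b b' * ((S a n₂ * S a' n₁) * (S b n₃ * S b' n₀)) +
        LA a a' * LB b b' * ((S a n₂ * S a' n₃) * (S b n₀ * S b' n₁)) +
        LA a a' * LB b b' * ((S a n₂ * S a' n₃) * (S b n₁ * S b' n₀)) +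
        LA a a' * LB b b' * ((S a n₃ * S a' n₀) * (S b n₁ * S b' n₂)) +
        LA a a' * LB b b' * ((S a n₃ * S a' n₀) * (S b n₂ * S b' n₁)) +
        LA a a' * LB b b' * ((S a n₃ * S a' n₁) * (S b n₀ * S b' n₂)) +
        LA a a' * LB b b' * ((S a n₃ * S a' n₁) * (S b n₂ * S b' n₀)) +
        LA a a' * LB b b' * ((S a n₃ * S a' n₂) * (S b n₀ * S b' n₁)) +
        LA a a' * LB b b' * ((S a n₃ * S a' n₂) * (S b n₁ * S b' n₀)))) =
      DA n₂ n₀ * DB n₁ n₃ +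
      DA n₂ n₀ * DB n₃ n₁ +
      DA n₂ n₁ * DB n₀ n₃ +
      DA n₂ n₁ * DB n₃ n₀ +
      DA n₂ n₃ * DB n₀ n₁ +
      DA n₂ n₃ * DB n₁ n₀ +
      DA n₃ n₀ * DB n₁ n₂ +
      DA n₃ n₀ * DB n₂ n₁ +
      DA n₃ n₁ * DB n₀ n₂ +
      DA n₃ n₁ * DB n₂ n₀ +
      DA n₃ n₂ * DB n₀ n₁ +
      DA n₃ n₂ * DB n₁ n₀ := by
  simp only [Finset.sum_add_distrib, hXc]

/-- Collapse of twelve pairings of one shape group (`T1`), given the shape collapses. -/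
theorem sumLL_T1 {ι : Type*} [Fintype ι] (LA LB S TD : ι → ι → ℝ)
    (hT1 : ∀ (P Q : ι) (c : ℝ), (∑ a, ∑ a', ∑ b, ∑ b', LA a a' * LB b b' * (((S a b * S a' P) * S b' Q) * c)) = TD P Q * c)
    (n₀ n₁ n₂ n₃ : ι) :
    (∑ a, ∑ a', ∑ b, ∑ b',
      (LA a a' * LB b b' * (((S a b * S a' n₀) * S b' n₁) * S n₂ n₃) +
        LA a a' * LB b b' * (((S a b * S a' n₀) * S b' n₂) * S n₁ n₃) +
        LA a a' * LB b b' * (((S a b * S a' n₀) * S b' n₃) * S n₁ n₂) +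
        LA a a' * LB b b' * (((S a b * S a' n₁) * S b' n₀) * S n₂ n₃) +
        LA a a' * LB b b' * (((S a b * S a' n₁) * S b' n₂) * S n₀ n₃) +
        LA a a' * LB b b' * (((S a b * S a' n₁) * S b' n₃) * S n₀ n₂) +
        LA a a' * LB b b' * (((S a b * S a' n₂) * S b' n₀) * S n₁ n₃) +
        LA a a' * LB b b' * (((S a b * S a' n₂) * S b' n₁) * S n₀ n₃) +
        LA a a' * LB b b' * (((S a b * S a' n₂) * S b' n₃) * S n₀ n₁) +
        LA a a' * LB b b' * (((S a b * S a' n₃) * S b' n₀) * S n₁ n₂) +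
        LA a a' * LB b b' * (((S a b * S a' n₃) * S b' n₁) * S n₀ n₂) +
        LA a a' * LB b b' * (((S a b * S a' n₃) * S b' n₂) * S n₀ n₁))) =
      TD n₀ n₁ * S n₂ n₃ +
      TD n₀ n₂ * S n₁ n₃ +
      TD n₀ n₃ * S n₁ n₂ +
      TD n₁ n₀ * S n₂ n₃ +
      TD n₁ n₂ * S n₀ n₃ +
      TD n₁ n₃ * S n₀ n₂ +
      TD n₂ n₀ * S n₁ n₃ +
      TD n₂ n₁ * S n₀ n₃ +
      TD n₂ n₃ * S n₀ n₁ +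
      TD n₃ n₀ * S n₁ n₂ +
      TD n₃ n₁ * S n₀ n₂ +
      TD n₃ n₂ * S n₀ n₁ := by
  simp only [Finset.sum_add_distrib, hT1]

/-- Collapse of twelve pairings of one shape group (`T2`), given the shape collapses. -/
theorem sumLL_T2 {ι : Type*} [Fintype ι] (LA LB S TD : ι → ι → ℝ)
    (hT2 : ∀ (P Q : ι) (c : ℝ), (∑ a, ∑ a', ∑ b, ∑ b', LA a a' * LB b b' * (((S a b' * S a' P) * S b Q) * c)) = TD P Q * c)
    (n₀ n₁ n₂ n₃ : ι) :
    (∑ a, ∑ a', ∑ b, ∑ b',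
      (LA a a' * LB b b' * (((S a b' * S a' n₀) * S b n₁) * S n₂ n₃) +
        LA a a' * LB b b' * (((S a b' * S a' n₀) * S b n₂) * S n₁ n₃) +
        LA a a' * LB b b' * (((S a b' * S a' n₀) * S b n₃) * S n₁ n₂) +
        LA a a' * LB b b' * (((S a b' * S a' n₁) * S b n₀) * S n₂ n₃) +
        LA a a' * LB b b' * (((S a b' * S a' n₁) * S b n₂) * S n₀ n₃) +
        LA a a' * LB b b' * (((S a b' * S a' n₁) * S b n₃) * S n₀ n₂) +
        LA a a' * LB b b' * (((S a b' * S a' n₂) * S b n₀) * S n₁ n₃) +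
        LA a a' * LB b b' * (((S a b' * S a' n₂) * S b n₁) * S n₀ n₃) +
        LA a a' * LB b b' * (((S a b' * S a' n₂) * S b n₃) * S n₀ n₁) +
        LA a a' * LB b b' * (((S a b' * S a' n₃) * S b n₀) * S n₁ n₂) +
        LA a a' * LB b b' * (((S a b' * S a' n₃) * S b n₁) * S n₀ n₂) +
        LA a a' * LB b b' * (((S a b' * S a' n₃) * S b n₂) * S n₀ n₁))) =
      TD n₀ n₁ * S n₂ n₃ +
      TD n₀ n₂ * S n₁ n₃ +
      TD n₀ n₃ * S n₁ n₂ +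
      TD n₁ n₀ * S n₂ n₃ +
      TD n₁ n₂ * S n₀ n₃ +
      TD n₁ n₃ * S n₀ n₂ +
      TD n₂ n₀ * S n₁ n₃ +
      TD n₂ n₁ * S n₀ n₃ +
      TD n₂ n₃ * S n₀ n₁ +
      TD n₃ n₀ * S n₁ n₂ +
      TD n₃ n₁ * S n₀ n₂ +
      TD n₃ n₂ * S n₀ n₁ := by
  simp only [Finset.sum_add_distrib, hT2]

/-- Collapse of twelve pairings of one shape group (`T3`), given the shape collapses. -/
theorem sumLL_T3 {ι : Type*} [Fintype ι] (LA LB S TD : ι → ι → ℝ)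
    (hT3 : ∀ (P Q : ι) (c : ℝ), (∑ a, ∑ a', ∑ b, ∑ b', LA a a' * LB b b' * (((S a P * S a' b) * S b' Q) * c)) = TD P Q * c)
    (n₀ n₁ n₂ n₃ : ι) :
    (∑ a, ∑ a', ∑ b, ∑ b',
      (LA a a' * LB b b' * (((S a n₀ * S a' b) * S b' n₁) * S n₂ n₃) +
        LA a a' * LB b b' * (((S a n₀ * S a' b) * S b' n₂) * S n₁ n₃) +
        LA a a' * LB b b' * (((S a n₀ * S a' b) * S b' n₃) * S n₁ n₂) +
        LA a a' * LB b b' * (((S a n₁ * S a' b) * S b' n₀) * S n₂ n₃) +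
        LA a a' * LB b b' * (((S a n₁ * S a' b) * S b' n₂) * S n₀ n₃) +
        LA a a' * LB b b' * (((S a n₁ * S a' b) * S b' n₃) * S n₀ n₂) +
        LA a a' * LB b b' * (((S a n₂ * S a' b) * S b' n₀) * S n₁ n₃) +
        LA a a' * LB b b' * (((S a n₂ * S a' b) * S b' n₁) * S n₀ n₃) +
        LA a a' * LB b b' * (((S a n₂ * S a' b) * S b' n₃) * S n₀ n₁) +
        LA a a' * LB b b' * (((S a n₃ * S a' b) * S b' n₀) * S n₁ n₂) +
        LA a a' * LB b b' * (((S a n₃ * S a' b) * S b' n₁) * S n₀ n₂) +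
        LA a a' * LB b b' * (((S a n₃ * S a' b) * S b' n₂) * S n₀ n₁))) =
      TD n₀ n₁ * S n₂ n₃ +
      TD n₀ n₂ * S n₁ n₃ +
      TD n₀ n₃ * S n₁ n₂ +
      TD n₁ n₀ * S n₂ n₃ +
      TD n₁ n₂ * S n₀ n₃ +
      TD n₁ n₃ * S n₀ n₂ +
      TD n₂ n₀ * S n₁ n₃ +
      TD n₂ n₁ * S n₀ n₃ +
      TD n₂ n₃ * S n₀ n₁ +
      TD n₃ n₀ * S n₁ n₂ +
      TD n₃ n₁ * S n₀ n₂ +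
      TD n₃ n₂ * S n₀ n₁ := by
  simp only [Finset.sum_add_distrib, hT3]

/-- Collapse of twelve pairings of one shape group (`T4`), given the shape collapses. -/
theorem sumLL_T4 {ι : Type*} [Fintype ι] (LA LB S TD : ι → ι → ℝ)
    (hT4 : ∀ (P Q : ι) (c : ℝ), (∑ a, ∑ a', ∑ b, ∑ b', LA a a' * LB b b' * (((S a P * S a' b') * S b Q) * c)) = TD P Q * c)
    (n₀ n₁ n₂ n₃ : ι) :
    (∑ a, ∑ a', ∑ b, ∑ b',
      (LA a a' * LB b b' * (((S a n₀ * S a' b') * S b n₁) * S n₂ n₃) +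
        LA a a' * LB b b' * (((S a n₀ * S a' b') * S b n₂) * S n₁ n₃) +
        LA a a' * LB b b' * (((S a n₀ * S a' b') * S b n₃) * S n₁ n₂) +
        LA a a' * LB b b' * (((S a n₁ * S a' b') * S b n₀) * S n₂ n₃) +
        LA a a' * LB b b' * (((S a n₁ * S a' b') * S b n₂) * S n₀ n₃) +
        LA a a' * LB b b' * (((S a n₁ * S a' b') * S b n₃) * S n₀ n₂) +
        LA a a' * LB b b' * (((S a n₂ * S a' b') * S b n₀) * S n₁ n₃) +
        LA a a' * LB b b' * (((S a n₂ * S a' b') * S b n₁) * S n₀ n₃) +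
        LA a a' * LB b b' * (((S a n₂ * S a' b') * S b n₃) * S n₀ n₁) +
        LA a a' * LB b b' * (((S a n₃ * S a' b') * S b n₀) * S n₁ n₂) +
        LA a a' * LB b b' * (((S a n₃ * S a' b') * S b n₁) * S n₀ n₂) +
        LA a a' * LB b b' * (((S a n₃ * S a' b') * S b n₂) * S n₀ n₁))) =
      TD n₀ n₁ * S n₂ n₃ +
      TD n₀ n₂ * S n₁ n₃ +
      TD n₀ n₃ * S n₁ n₂ +
      TD n₁ n₀ * S n₂ n₃ +
      TD n₁ n₂ * S n₀ n₃ +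
      TD n₁ n₃ * S n₀ n₂ +
      TD n₂ n₀ * S n₁ n₃ +
      TD n₂ n₁ * S n₀ n₃ +
      TD n₂ n₃ * S n₀ n₁ +
      TD n₃ n₀ * S n₁ n₂ +
      TD n₃ n₁ * S n₀ n₂ +
      TD n₃ n₂ * S n₀ n₁ := by
  simp only [Finset.sum_add_distrib, hT4]


end Summit.QuantumFields.YangMills.Theorems.AllWindowsColdBoxBoxHighLine

end
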